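import Summits.QuantumFields.BalabanUV.Beta.D1BFx.LandauDictionaryInstance
import Summits.QuantumFields.BalabanUV.Beta.FP.PerfectTelescopingFinite
import Summits.QuantumFields.BalabanUV.Beta.GAN24.TransverseDictionary

/-!
# `BalabanUV.Beta.D1BFx.LandauResolventSuperpositionRight` — road «BF-x», slot (K), brick B6′: THE RIGHT-INVERSE FORM OF X₁b
# from the landed LEFT-inverse form (`LandauResolventSuperposition.X1b_of_X1a`) + SYMMETRY of the gluon leg `Ga`

HONEST FRAMING (cell contract, verbatim): «discharging `BetaPertH` makes Bałaban's UV stability UNCONDITIONAL — a real constructive-QFT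
result; it is NOT the continuum limit and NOT the Clay problem.»  HONEST DEPENDENCY (verbatim): «continuum YM on T⁴ ⇐ BetaPertH ∧ nine
spine estimates (0/9 proved); BetaPertH ⇐ (D1) ∧ (D4) ∧ CAP+tail; G-an2-4 gates asym, D1 and NE2/3/4.»  THIS MODULE DISCHARGES NOTHING of
D1 ∕ BetaPertH: [folklore] finite-sum ∕ summability bookkeeping.  The vector-leg equation X₁a stays a DISPLAYED HYPOTHESIS `hX1a` (free `(r, a′, c)`);
the symmetry `hGaSymm : Ga x z κ m = Ga z x m κ` is a DISPLAYED HYPOTHESIS (for the road's leg it is `GluonLeg.Ga_symm`).  No `def`,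
no `def … : Prop`, nothing cited, 0 sorry.  NOT summit progress; NOT BetaPertH, NOT continuum, NOT Clay.

ABSOLUTE RULE (cell, verbatim): «No internally-minted statement may enter as a cited fact. Every hypothesis is either kernel-proved in this
package or a verbatim quotation of a PUBLISHED theorem with page reference. The manuscript(s) under audit are NOT citable for their own
disputed steps — they are the thing under adjudication; programme-internal (2001/route/tribunal) claims are never citable.»

WHY (cross-read C-ne9leaf06g28-1 ∕ located remark R-ne9leaf06g28-1 on p233365).  `X1b_of_X1a` is the KERNEL identity
`Σ_{(l,y′)} L((κ,y),(l,y′)) · T((l,y′),(l₀,y₀)) = c·δ` with `L := a′·δ + wΦ κ l (y − y′)` and `T((κ,y),(l₀,y₀)) := (𝒬Ga𝒬ᵀ e_{(l₀,y₀)})(κ,y)`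
— `L∘T = c·1`, the LEFT inverse; K-R1-SPEC v2 §4 X₁(b) (`(𝒬Ga𝒬ᵀ)·Cun = 1`) and B6's binder `hX1b` (`LandauDictionaryHWeighted.wH_eq_HRcol_w`)
are the RIGHT inverse `T∘L = c·1` — not formally equivalent on an infinite index set; here `T` is SYMMETRIC as soon as `Ga` is (finite double
leg sum, §1–§2) and `L` is symmetric by `TransverseDictionary.wΦ_reciprocity`, so the left identity at swapped indices IS the right identity (§3).

CONTENT (block side `n ≥ 1`; all [folklore]).
* §1 `kerOp₁_contourSumAdj_unitSrc`: `(Ga𝒬ᵀ e_{(l₀,y₀)})(κ,x) = Σ_{i ∈ LegIdx} Ga x (legPt n l₀ y₀ i) κ l₀` (finite leg sum; `FP.PerfectTelescopingFinite`).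
* §2 `Tcol_eq` (`T` as a double leg sum), **`Tcol_symm`** (`T((κ,y),(l₀,y₀)) = T((l₀,y₀),(κ,y))` ⟸ `hGaSymm`).
* §3 **`X1b_right_of_X1a`**: `c·δ = a′·T((κ,y),(l₀,y₀)) + Σ'_{y′} Σ_l T((κ,y),(l,y′)) · wΦ l l₀ (y′ − y₀)` ⟸ `hX1a` ∧ `hGaSymm`.
* §4 (uses `Decays Ga`) `kerOp₁_contourSumAdj_eq_tsum` ∕ `T_apply_eq_tsum` (kernel representation of `Ga𝒬ᵀ` ∕ `𝒬Ga𝒬ᵀ` on BOUNDED coarse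
  sources — an4's `DecLiftAdjoint.tsum_mul_contourSum` + `BoundedSuperposition.summable_exp_decimated`), **`T_apply_shiftedMultiplier`** (the
  OPERATOR right inverse `(𝒬Ga𝒬ᵀ)∘(a′ + wΦ⋆) = c·1`), **`hX1b_of_X1a`** (B6's binder `hX1b` LITERALLY, at `Cun′ := c⁻¹·(a′δ + wΦ)`, `c ≠ 0`).
* §5 `spr_shiftedMultiplier`, **`wH_eq_HRcol_of_X1a`** = B6's END `wH_eq_HRcol_w` with `hX1b` DISCHARGED: (D-H) `wH(·;l) = Ga𝒬ᵀCun′(·;l)`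
  modulo X₁a, `Spr Ga`, `hGaSymm` only.
* §6 **`hX1b_Ga`**: B6's `hX1b` at the road's legs `Ga (m+1) a` (owner's `hX1a_Ga`, `GluonLeg.Ga_symm`, `spr_Ga_of_prop12`) modulo `h12 ∧ h126`.
Unit `b2b-balaban-t4-ne9-formalise-leaf-06` (gen 28; cross-reader of p233365), 2026-08-20.
-/

namespace Summit.QuantumFields.BalabanUV.Beta.D1BFx.LandauResolventSuperpositionRight

open Finset
open scoped BigOperators
open Literature.MathematicalPhysics.QuantumFieldTheory.Balaban1983to89
open Literature.MathematicalPhysics.QuantumFieldTheory.Balaban1983to89.Beta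
open Literature.MathematicalPhysics.QuantumFieldTheory.LatticeForm (quo)
open ExpKernelCalculus (Site MKer Decays)
open AffineAveraging (Form0 Form1 box toSite unitVec dz curv curvAdj codiff₁ contourSum)
open AffineReproduction (contourSumAdj)
open KKTFluctuationKernel (delta1)
open B12Sec2to5 (l1)
open ExpKernelCalculus (summable_exp_shift)
open KernelSpecInstance (wH wΦ wM contourSum_smul contourSumAdj_smul)
open KKTFluctuationUnique (abs_le_of_decay510)
open OneStepKernelFamily (l1_neg_eq)
open LandauDictionaryH (abs_contourSumAdj_le)
open DecLiftAdjoint (tsum_mul_contourSum)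
open OneStepResolventKernel (Fib)
open OneStepKernelFamily (legPt LegIdx)
open BalabanCompositeJets (bshift l1_zero')
open Summit.QuantumFields.BalabanUV.Beta.TameKernelCalculus (Spr)
open StepDriftWitness (sum_LegIdx_eq_contourSum legPt_inl_eq)
open KernelFormOperators (kerOp₁ Rf)
open LandauResolventSuperposition (unitSrc X1b_of_X1a)
open Summit.QuantumFields.BalabanUV.Beta.FP.PerfectTelescopingFinite (contourSumAdj_eq_sum_bshift tsum_mul_contourSum_of_finite)
open Summit.QuantumFields.BalabanUV.Beta.GAN24.TransverseDictionary (wΦ_reciprocity)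

noncomputable section

variable (n : ℕ) [NeZero n] (a : ℝ)

/-! ## §1 The `Ga𝒬ᵀ`-column of a unit coarse source is a finite leg sum -/

omit [NeZero n] in
/-- [folklore] The unit source seen through `𝒬ᵀ` on the `l`-component: zero off `l = l₀`, the indicator of the `y₀`-fibre on `l = l₀`. -/
theorem sum_mul_contourSumAdj_unitSrc (Ga : MKer 4 (Fin 4)) (l₀ : Fin 4) (y₀ : Site 4) (κ : Fin 4) (x z : Site 4) :
    ∑ l, Ga x z κ l * contourSumAdj n (unitSrc l₀ y₀) l z
      = Ga x z κ l₀ * ∑ s ∈ Finset.range n, (if quo n (z - bshift 3 l₀ s) = y₀ then (1 : ℝ) else 0) := by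
  classical
  rw [Finset.sum_eq_single l₀ (fun l _ hl => ?_) (fun h => absurd (Finset.mem_univ _) h)]
  · rw [contourSumAdj_eq_sum_bshift]
    congr 1
    refine Finset.sum_congr rfl fun s _ => ?_
    simp [LandauResolventSuperposition.unitSrc]
  · rw [contourSumAdj_eq_sum_bshift]
    have h0 : ∀ s : ℕ, unitSrc l₀ y₀ l (quo n (z - bshift 3 l s)) = 0 := fun s => by
      simp [LandauResolventSuperposition.unitSrc, hl]
    simp [h0]

/-- [folklore] **`(Ga𝒬ᵀ e_{(l₀,y₀)})(κ, x) = Σ_{i ∈ LegIdx} Ga x (legPt n l₀ y₀ i) κ l₀`** — the column of `Ga𝒬ᵀ` at a unit coarse source is the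
FINITE sum of `Ga x · κ l₀` over the `n^5` contour legs of the coarse bond `(l₀, y₀)` (no decay of `Ga` needed). -/
theorem kerOp₁_contourSumAdj_unitSrc (Ga : MKer 4 (Fin 4)) (l₀ : Fin 4) (y₀ : Site 4) (κ : Fin 4) (x : Site 4) :
    kerOp₁ Ga (contourSumAdj n (unitSrc l₀ y₀)) κ x
      = ∑ i ∈ LegIdx 3 n, Ga x (legPt n (Sum.inl l₀ : Fib 3) y₀ i) κ l₀ := by
  classical
  have hfin : (Function.support fun y : Site 4 => if y = y₀ then (1 : ℝ) else 0).Finite := by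
    refine (Set.finite_singleton y₀).subset fun y hy => ?_
    rw [Function.mem_support] at hy
    by_cases h : y = y₀
    · exact h
    · exact absurd (if_neg h) hy
  show (∑' z : Site 4, ∑ l, Ga x z κ l * contourSumAdj n (unitSrc l₀ y₀) l z) = _
  simp only [sum_mul_contourSumAdj_unitSrc]
  rw [tsum_mul_contourSum_of_finite (fun z => Ga x z κ l₀) (fun y => if y = y₀ then (1 : ℝ) else 0) hfin n l₀,
    tsum_eq_single y₀ (fun y hy => by simp [hy])]
  simp

/-! ## §2 The coarse two-point kernel `T := 𝒬Ga𝒬ᵀ` as a double leg sum; symmetry -/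

/-- [folklore] **`T((κ,y),(l₀,y₀)) = Σ_{j} Σ_{i} Ga (legPt n κ y j) (legPt n l₀ y₀ i) κ l₀`** (both sums over `LegIdx 3 n`). -/
theorem Tcol_eq (Ga : MKer 4 (Fin 4)) (l₀ : Fin 4) (y₀ : Site 4) (κ : Fin 4) (y : Site 4) :
    contourSum n (kerOp₁ Ga (contourSumAdj n (unitSrc l₀ y₀))) κ y
      = ∑ j ∈ LegIdx 3 n, ∑ i ∈ LegIdx 3 n,
          Ga (legPt n (Sum.inl κ : Fib 3) y j) (legPt n (Sum.inl l₀ : Fib 3) y₀ i) κ l₀ := by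
  rw [← sum_LegIdx_eq_contourSum n κ _ y]
  exact Finset.sum_congr rfl fun j _ => kerOp₁_contourSumAdj_unitSrc n Ga l₀ y₀ κ _

/-- [folklore] **`T := 𝒬Ga𝒬ᵀ` IS SYMMETRIC WHEN `Ga` IS**: `T((κ,y),(l₀,y₀)) = T((l₀,y₀),(κ,y))`. -/
theorem Tcol_symm {Ga : MKer 4 (Fin 4)} (hGaSymm : ∀ x z κ m, Ga x z κ m = Ga z x m κ)
    (l₀ : Fin 4) (y₀ : Site 4) (κ : Fin 4) (y : Site 4) :
    contourSum n (kerOp₁ Ga (contourSumAdj n (unitSrc l₀ y₀))) κ y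
      = contourSum n (kerOp₁ Ga (contourSumAdj n (unitSrc κ y))) l₀ y₀ := by
  rw [Tcol_eq, Tcol_eq, Finset.sum_comm]
  exact Finset.sum_congr rfl fun i _ => Finset.sum_congr rfl fun j _ => hGaSymm _ _ _ _

/-! ## §3 The RIGHT-inverse form of X₁b -/

/-- [folklore] **X₁b IN RIGHT-INVERSE FORM ⟸ X₁a ∧ `Ga` symmetric**: for every pair of coarse bonds,
`c·δ_{(κ,y),(l₀,y₀)} = a′·T((κ,y),(l₀,y₀)) + Σ'_{y′} Σ_l T((κ,y),(l,y′)) · wΦ l l₀ (y′ − y₀)`, `T := 𝒬Ga𝒬ᵀ` — i.e. `T∘(a′ + wΦ⋆) = c·1`,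
the coarse operator composed with the shifted constraint multiplier ON THE RIGHT (the order of K-R1-SPEC v2 §4 X₁(b) and of B6's `hX1b`).
From `X1b_of_X1a` (the LEFT form `(a′ + wΦ⋆)∘T = c·1`) read at the swapped pair, `Tcol_symm` and `wΦ_reciprocity`. -/
theorem X1b_right_of_X1a {Ga : MKer 4 (Fin 4)} {C δ : ℝ} {r a' c : ℝ}
    (ha : 0 < a) (hr : r ≠ 0) (hGa : Decays Ga C δ) (hδ : 0 < δ)
    (hX1a : ∀ (m : Fin 4) (z : Site 4) (κ : Fin 4) (x : Site 4),
      curvAdj (curv (fun κ' p => Ga p z κ' m)) κ x = c * delta1 m z κ x - r * dz (Rf n a (codiff₁ (fun κ' p => Ga p z κ' m))) κ x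
        - a' * contourSumAdj n (contourSum n (fun κ' p => Ga p z κ' m)) κ x)
    (hGaSymm : ∀ x z κ m, Ga x z κ m = Ga z x m κ)
    (l₀ : Fin 4) (y₀ : Site 4) (κ : Fin 4) (y : Site 4) :
    c * (if y = y₀ ∧ κ = l₀ then 1 else 0)
      = a' * contourSum n (kerOp₁ Ga (contourSumAdj n (unitSrc l₀ y₀))) κ y
        + ∑' y' : Site 4, ∑ l, contourSum n (kerOp₁ Ga (contourSumAdj n (unitSrc l y'))) κ y * wΦ (N := n) l l₀ (y' - y₀) := by
  have h := X1b_of_X1a n a ha hr hGa hδ hX1a κ y l₀ y₀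
  have hite : (if y = y₀ ∧ κ = l₀ then (1 : ℝ) else 0) = (if y₀ = y ∧ l₀ = κ then 1 else 0) :=
    if_congr ⟨fun hh => ⟨hh.1.symm, hh.2.symm⟩, fun hh => ⟨hh.1.symm, hh.2.symm⟩⟩ rfl rfl
  rw [hite, h, ← Tcol_symm n hGaSymm l₀ y₀ κ y]
  congr 1
  refine tsum_congr fun y' => Finset.sum_congr rfl fun l _ => ?_
  rw [wΦ_reciprocity (N := n) l₀ l y₀ y', Tcol_symm n hGaSymm l y' κ y, mul_comm]

/-! ## §4 The operator form: `𝒬Ga𝒬ᵀ` on a bounded coarse source through its column kernel; B6's `hX1b` shape -/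

section Operator

variable {Ga : MKer 4 (Fin 4)} {C δ Mω : ℝ} {ω : Form1 4 ℝ}

omit [NeZero n] in
/-- [folklore] The fine family `z ↦ Ga x z κ l · (𝒬ᵀω) l z` is summable (decay of `Ga`, bounded `ω`). -/
theorem summable_col_mul_contourSumAdj (hGa : Decays Ga C δ) (hδ : 0 < δ) (hω : ∀ κ y, |ω κ y| ≤ Mω)
    (κ l : Fin 4) (x : Site 4) :
    Summable fun z : Site 4 => Ga x z κ l * contourSumAdj n ω l z := by
  refine Summable.of_norm_bounded (((summable_exp_shift hδ x).mul_left C).mul_right ((n : ℝ) * Mω)) fun z => ?_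
  rw [Real.norm_eq_abs, abs_mul]
  exact mul_le_mul (hGa x z κ l) (abs_contourSumAdj_le n hω l z) (abs_nonneg _) ((abs_nonneg _).trans (hGa x z κ l))

omit [NeZero n] in
/-- [folklore] The entries of `Ga` along the contour legs of the coarse bond `(l, y′)` decay in `y′` (decimated exponential family). -/
theorem abs_Ga_legPt_le (hGa : Decays Ga C δ) (κ l : Fin 4) (x y' : Site 4) (i : (Fin (3 + 1) → ℕ) × ℕ) :
    |Ga x (legPt n (Sum.inl l : Fib 3) y' i) κ l|
      ≤ C * Real.exp (-δ * l1 ((x - (toSite i.1 + (i.2 : ℤ) • unitVec l)) - (n : ℤ) • y')) := by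
  have h := hGa x (legPt n (Sum.inl l : Fib 3) y' i) κ l
  have e : x - legPt n (Sum.inl l : Fib 3) y' i = (x - (toSite i.1 + (i.2 : ℤ) • unitVec l)) - (n : ℤ) • y' := by
    rw [legPt_inl_eq]; abel
  rwa [e] at h

/-- [folklore] The coarse family `y′ ↦ (Ga𝒬ᵀ e_{(l,y′)})(κ,x) · ω l y′` is summable. -/
theorem summable_kerOp₁_unitSrc_mul (hGa : Decays Ga C δ) (hδ : 0 < δ) (hω : ∀ κ y, |ω κ y| ≤ Mω)
    (κ l : Fin 4) (x : Site 4) :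
    Summable fun y' : Site 4 => kerOp₁ Ga (contourSumAdj n (unitSrc l y')) κ x * ω l y' := by
  have hn : (n : ℕ) ≠ 0 := NeZero.ne n
  have hg : Summable fun y' : Site 4 =>
      (∑ i ∈ LegIdx 3 n, C * Real.exp (-δ * l1 ((x - (toSite i.1 + (i.2 : ℤ) • unitVec l)) - (n : ℤ) • y'))) * Mω := by
    refine Summable.mul_right Mω (summable_sum (s := LegIdx 3 n) fun i _ => ?_)
    exact (BoundedSuperposition.summable_exp_decimated (M := n) hn hδ (x - (toSite i.1 + (i.2 : ℤ) • unitVec l))).mul_left C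
  refine Summable.of_norm_bounded hg fun y' => ?_
  rw [Real.norm_eq_abs, abs_mul, kerOp₁_contourSumAdj_unitSrc]
  have hsum : |∑ i ∈ LegIdx 3 n, Ga x (legPt n (Sum.inl l : Fib 3) y' i) κ l|
      ≤ ∑ i ∈ LegIdx 3 n, C * Real.exp (-δ * l1 ((x - (toSite i.1 + (i.2 : ℤ) • unitVec l)) - (n : ℤ) • y')) :=
    (Finset.abs_sum_le_sum_abs _ _).trans (Finset.sum_le_sum fun i _ => abs_Ga_legPt_le n hGa κ l x y' i)
  exact mul_le_mul hsum (hω l y') (abs_nonneg _)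
    (Finset.sum_nonneg fun i _ => (abs_nonneg _).trans (abs_Ga_legPt_le n hGa κ l x y' i))

/-- [folklore] **KERNEL REPRESENTATION OF `Ga𝒬ᵀ` ON BOUNDED COARSE SOURCES**:
`(Ga𝒬ᵀω)(κ,x) = Σ'_{y′} Σ_l (Ga𝒬ᵀ e_{(l,y′)})(κ,x) · ω l y′` (an4's stencil-index swap `DecLiftAdjoint.tsum_mul_contourSum`). -/
theorem kerOp₁_contourSumAdj_eq_tsum (hGa : Decays Ga C δ) (hδ : 0 < δ) (hω : ∀ κ y, |ω κ y| ≤ Mω)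
    (κ : Fin 4) (x : Site 4) :
    kerOp₁ Ga (contourSumAdj n ω) κ x
      = ∑' y' : Site 4, ∑ l, kerOp₁ Ga (contourSumAdj n (unitSrc l y')) κ x * ω l y' := by
  calc kerOp₁ Ga (contourSumAdj n ω) κ x
      = ∑' z : Site 4, ∑ l, Ga x z κ l * contourSumAdj n ω l z := rfl
    _ = ∑ l, ∑' z : Site 4, Ga x z κ l * contourSumAdj n ω l z :=
        Summable.tsum_finsetSum fun l _ => summable_col_mul_contourSumAdj n hGa hδ hω κ l x
    _ = ∑ l, ∑' y' : Site 4, (∑ i ∈ LegIdx 3 n, Ga x (legPt n (Sum.inl l : Fib 3) y' i) κ l) * ω l y' := by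
        refine Finset.sum_congr rfl fun l _ => ?_
        have hc : ∀ u : Site 4, |Ga x u κ l| ≤ C * Real.exp (-δ * l1 (u - x)) := fun u => by
          rw [← neg_sub x u, l1_neg_eq]; exact hGa x u κ l
        have h := tsum_mul_contourSum (d := 3) (c := fun z => Ga x z κ l) (A := ω l) hc hδ (fun z => hω l z) n l
        rw [← h]
        exact tsum_congr fun z => by rw [contourSumAdj_eq_sum_bshift]
    _ = ∑ l, ∑' y' : Site 4, kerOp₁ Ga (contourSumAdj n (unitSrc l y')) κ x * ω l y' := by
        simp only [kerOp₁_contourSumAdj_unitSrc]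
    _ = ∑' y' : Site 4, ∑ l, kerOp₁ Ga (contourSumAdj n (unitSrc l y')) κ x * ω l y' :=
        (Summable.tsum_finsetSum fun l _ => summable_kerOp₁_unitSrc_mul n hGa hδ hω κ l x).symm

/-- [folklore] The coarse family `y′ ↦ T((κ,y),(l,y′)) · ω l y′` is summable. -/
theorem summable_Tcol_mul (hGa : Decays Ga C δ) (hδ : 0 < δ) (hω : ∀ κ y, |ω κ y| ≤ Mω)
    (κ l : Fin 4) (y : Site 4) :
    Summable fun y' : Site 4 => contourSum n (kerOp₁ Ga (contourSumAdj n (unitSrc l y'))) κ y * ω l y' := by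
  have h := summable_sum (s := LegIdx 3 n) fun j _ =>
    summable_kerOp₁_unitSrc_mul n hGa hδ hω κ l (legPt n (Sum.inl κ : Fib 3) y j)
  refine h.congr fun y' => ?_
  show (∑ j ∈ LegIdx 3 n, kerOp₁ Ga (contourSumAdj n (unitSrc l y')) κ (legPt n (Sum.inl κ : Fib 3) y j) * ω l y') = _
  rw [← Finset.sum_mul, sum_LegIdx_eq_contourSum n κ _ y]

/-- [folklore] **KERNEL REPRESENTATION OF `T := 𝒬Ga𝒬ᵀ` ON BOUNDED COARSE SOURCES**:
`(𝒬Ga𝒬ᵀω)(κ,y) = Σ'_{y′} Σ_l T((κ,y),(l,y′)) · ω l y′`. -/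
theorem T_apply_eq_tsum (hGa : Decays Ga C δ) (hδ : 0 < δ) (hω : ∀ κ y, |ω κ y| ≤ Mω) (κ : Fin 4) (y : Site 4) :
    contourSum n (kerOp₁ Ga (contourSumAdj n ω)) κ y
      = ∑' y' : Site 4, ∑ l, contourSum n (kerOp₁ Ga (contourSumAdj n (unitSrc l y'))) κ y * ω l y' := by
  calc contourSum n (kerOp₁ Ga (contourSumAdj n ω)) κ y
      = ∑ j ∈ LegIdx 3 n, kerOp₁ Ga (contourSumAdj n ω) κ (legPt n (Sum.inl κ : Fib 3) y j) :=
        (sum_LegIdx_eq_contourSum n κ _ y).symm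
    _ = ∑ j ∈ LegIdx 3 n, ∑' y' : Site 4, ∑ l,
          kerOp₁ Ga (contourSumAdj n (unitSrc l y')) κ (legPt n (Sum.inl κ : Fib 3) y j) * ω l y' :=
        Finset.sum_congr rfl fun j _ => kerOp₁_contourSumAdj_eq_tsum n hGa hδ hω κ _
    _ = ∑' y' : Site 4, ∑ j ∈ LegIdx 3 n, ∑ l,
          kerOp₁ Ga (contourSumAdj n (unitSrc l y')) κ (legPt n (Sum.inl κ : Fib 3) y j) * ω l y' :=
        (Summable.tsum_finsetSum fun j _ => summable_sum fun l _ =>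
          summable_kerOp₁_unitSrc_mul n hGa hδ hω κ l _).symm
    _ = ∑' y' : Site 4, ∑ l, contourSum n (kerOp₁ Ga (contourSumAdj n (unitSrc l y'))) κ y * ω l y' := by
        refine tsum_congr fun y' => ?_
        rw [Finset.sum_comm]
        refine Finset.sum_congr rfl fun l _ => ?_
        rw [← Finset.sum_mul, sum_LegIdx_eq_contourSum n κ _ y]

variable {r a' c : ℝ}

/-- [folklore] **THE OPERATOR FORM OF X₁b (RIGHT INVERSE)**: `𝒬Ga𝒬ᵀ` APPLIED to the `(l₀, y₀)`-column of the shifted constraint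
multiplier `a′·δ + wΦ(· − y₀)` is `c` times the unit source — `(𝒬Ga𝒬ᵀ)∘(a′ + wΦ⋆) = c·1` as operators on bounded coarse sources. -/
theorem T_apply_shiftedMultiplier (ha : 0 < a) (hr : r ≠ 0) (hGa : Decays Ga C δ) (hδ : 0 < δ)
    (hX1a : ∀ (m : Fin 4) (z : Site 4) (κ : Fin 4) (x : Site 4),
      curvAdj (curv (fun κ' p => Ga p z κ' m)) κ x = c * delta1 m z κ x - r * dz (Rf n a (codiff₁ (fun κ' p => Ga p z κ' m))) κ x
        - a' * contourSumAdj n (contourSum n (fun κ' p => Ga p z κ' m)) κ x)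
    (hGaSymm : ∀ x z κ m, Ga x z κ m = Ga z x m κ)
    (l₀ : Fin 4) (y₀ : Site 4) (κ : Fin 4) (y : Site 4) :
    contourSum n (kerOp₁ Ga (contourSumAdj n
        (fun m y' => a' * (if y' = y₀ ∧ m = l₀ then 1 else 0) + wΦ (N := n) m l₀ (y' - y₀)))) κ y
      = c * (if y = y₀ ∧ κ = l₀ then 1 else 0) := by
  classical
  obtain ⟨δΦ, CΦ, hδΦ, hΦ⟩ := KernelSpecInstance.decay_wΦ (N := n) (d := 3)
  have hite : ∀ (m : Fin 4) (y' : Site 4), |a' * (if y' = y₀ ∧ m = l₀ then (1 : ℝ) else 0)| ≤ |a'| := fun m y' => by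
    rw [abs_mul]; exact mul_le_of_le_one_right (abs_nonneg _) (by split_ifs <;> simp)
  have hwΦ : ∀ (m : Fin 4) (y' : Site 4), |wΦ (N := n) m l₀ (y' - y₀)| ≤ CΦ := fun m y' =>
    abs_le_of_decay510 hδΦ (hΦ m l₀) _
  have hbd : ∀ (m : Fin 4) (y' : Site 4),
      |a' * (if y' = y₀ ∧ m = l₀ then (1 : ℝ) else 0) + wΦ (N := n) m l₀ (y' - y₀)| ≤ |a'| + CΦ := fun m y' =>
    (abs_add_le _ _).trans (add_le_add (hite m y') (hwΦ m y'))
  rw [T_apply_eq_tsum n hGa hδ hbd κ y, X1b_right_of_X1a n a ha hr hGa hδ hX1a hGaSymm l₀ y₀ κ y]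
  have hS1 : Summable fun y' : Site 4 => ∑ l, contourSum n (kerOp₁ Ga (contourSumAdj n (unitSrc l y'))) κ y
      * (a' * (if y' = y₀ ∧ l = l₀ then (1 : ℝ) else 0)) :=
    summable_sum fun l _ => summable_Tcol_mul n hGa hδ
      (ω := fun m y' => a' * (if y' = y₀ ∧ m = l₀ then (1 : ℝ) else 0)) hite κ l y
  have hS2 : Summable fun y' : Site 4 => ∑ l, contourSum n (kerOp₁ Ga (contourSumAdj n (unitSrc l y'))) κ y
      * wΦ (N := n) l l₀ (y' - y₀) :=
    summable_sum fun l _ => summable_Tcol_mul n hGa hδ (ω := fun m y' => wΦ (N := n) m l₀ (y' - y₀)) hwΦ κ l y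
  have hsplit : (fun y' : Site 4 => ∑ l, contourSum n (kerOp₁ Ga (contourSumAdj n (unitSrc l y'))) κ y
        * (a' * (if y' = y₀ ∧ l = l₀ then (1 : ℝ) else 0) + wΦ (N := n) l l₀ (y' - y₀)))
      = fun y' => (∑ l, contourSum n (kerOp₁ Ga (contourSumAdj n (unitSrc l y'))) κ y
          * (a' * (if y' = y₀ ∧ l = l₀ then (1 : ℝ) else 0)))
        + ∑ l, contourSum n (kerOp₁ Ga (contourSumAdj n (unitSrc l y'))) κ y * wΦ (N := n) l l₀ (y' - y₀) := by
    funext y'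
    rw [← Finset.sum_add_distrib]
    exact Finset.sum_congr rfl fun l _ => mul_add _ _ _
  rw [hsplit, hS1.tsum_add hS2]
  congr 1
  rw [tsum_eq_single y₀ (fun y' hy' => Finset.sum_eq_zero fun l _ => by simp [hy'])]
  rw [Finset.sum_eq_single l₀ (fun l _ hl => by simp [hl]) (fun h => absurd (Finset.mem_univ _) h)]
  simp [mul_comm]

/-- [folklore] `kerOp₁` is homogeneous in the source. -/
theorem kerOp₁_smul (Ga : MKer 4 (Fin 4)) (k : ℝ) (b : Form1 4 ℝ) : kerOp₁ Ga (k • b) = k • kerOp₁ Ga b := by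
  funext κ x
  simp only [KernelFormOperators.kerOp₁, Pi.smul_apply, smul_eq_mul]
  rw [← tsum_mul_left]
  exact tsum_congr fun z => by rw [Finset.mul_sum]; exact Finset.sum_congr rfl fun l _ => by ring

/-- [folklore] **B6's BINDER `hX1b` FROM X₁a ∧ `Ga` SYMMETRIC** (`c ≠ 0`): with the coarse kernel
`Cun′ y y₀ m l := c⁻¹·(a′·[y = y₀ ∧ m = l] + wΦ m l (y − y₀))` the `HRcol`-columns of `LandauDictionaryH` have unit block averages,
`𝒬(HRcol n Ga Cun′ l₀ 0) = δ_{(l₀,0)}` — LITERALLY the hypothesis `hX1b` of `LandauDictionaryHWeighted.wH_eq_HRcol_w` at `Cun := Cun′`. -/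
theorem hX1b_of_X1a (ha : 0 < a) (hr : r ≠ 0) (hc : c ≠ 0) (hGa : Decays Ga C δ) (hδ : 0 < δ)
    (hX1a : ∀ (m : Fin 4) (z : Site 4) (κ : Fin 4) (x : Site 4),
      curvAdj (curv (fun κ' p => Ga p z κ' m)) κ x = c * delta1 m z κ x - r * dz (Rf n a (codiff₁ (fun κ' p => Ga p z κ' m))) κ x
        - a' * contourSumAdj n (contourSum n (fun κ' p => Ga p z κ' m)) κ x)
    (hGaSymm : ∀ x z κ m, Ga x z κ m = Ga z x m κ)
    (l₀ κ : Fin 4) (y : Site 4) :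
    contourSum n (LandauDictionaryH.HRcol n Ga
        (fun y' y₀' m l => c⁻¹ * (a' * (if y' = y₀' ∧ m = l then 1 else 0) + wΦ (N := n) m l (y' - y₀'))) l₀ 0) κ y
      = if y = 0 ∧ κ = l₀ then 1 else 0 := by
  have hsrc : (fun m' y' => c⁻¹ * (a' * (if y' = (0 : Site 4) ∧ m' = l₀ then (1 : ℝ) else 0) + wΦ (N := n) m' l₀ (y' - 0)))
      = c⁻¹ • (fun m' y' => a' * (if y' = (0 : Site 4) ∧ m' = l₀ then (1 : ℝ) else 0) + wΦ (N := n) m' l₀ (y' - 0)) := by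
    funext m' y'; simp only [Pi.smul_apply, smul_eq_mul]
  show contourSum n (kerOp₁ Ga (contourSumAdj n (fun m' y' => c⁻¹ * (a' * (if y' = (0 : Site 4) ∧ m' = l₀ then (1 : ℝ) else 0)
      + wΦ (N := n) m' l₀ (y' - 0))))) κ y = _
  rw [hsrc, contourSumAdj_smul, kerOp₁_smul, contourSum_smul, Pi.smul_apply, Pi.smul_apply, smul_eq_mul,
    T_apply_shiftedMultiplier n a ha hr hGa hδ hX1a hGaSymm l₀ 0 κ y, inv_mul_cancel_left₀ hc]

end Operator

/-! ## §5 The END in B6's letters: (D-H) `wH = Ga𝒬ᵀ·Cun′` READ OFF from X₁a ∧ `Ga` symmetric ∧ `Spr Ga` -/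

section End

variable {r a' c : ℝ}

/-- [folklore] The shifted-multiplier coarse kernel `Cun′ y y₀ m l := c⁻¹·(a′·[y = y₀ ∧ m = l] + wΦ m l (y − y₀))` decays
(`KernelSpecInstance.decay_wΦ`), hence is `Spr`. -/
theorem spr_shiftedMultiplier (a' c : ℝ) :
    Spr (fun (y' y₀' : Site 4) (m l : Fin 4) =>
      c⁻¹ * (a' * (if y' = y₀' ∧ m = l then (1 : ℝ) else 0) + wΦ (N := n) m l (y' - y₀'))) := by
  obtain ⟨δΦ, CΦ, hδΦ, hΦ⟩ := KernelSpecInstance.decay_wΦ (N := n) (d := 3)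
  refine ⟨|c⁻¹| * (|a'| + CΦ), δΦ, hδΦ, fun y' y₀' m l => ?_⟩
  rw [abs_mul, mul_assoc]
  refine mul_le_mul_of_nonneg_left ?_ (abs_nonneg _)
  have h1 : |a' * (if y' = y₀' ∧ m = l then (1 : ℝ) else 0)| ≤ |a'| * Real.exp (-δΦ * l1 (y' - y₀')) := by
    rw [abs_mul]
    refine mul_le_mul_of_nonneg_left ?_ (abs_nonneg _)
    split_ifs with h
    · rw [h.1, sub_self, l1_zero', mul_zero, Real.exp_zero, abs_one]
    · rw [abs_zero]; exact (Real.exp_pos _).le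
  have h2 : |wΦ (N := n) m l (y' - y₀')| ≤ CΦ * Real.exp (-δΦ * l1 (y' - y₀')) := hΦ m l (y' - y₀')
  calc |a' * (if y' = y₀' ∧ m = l then (1 : ℝ) else 0) + wΦ (N := n) m l (y' - y₀')|
      ≤ |a'| * Real.exp (-δΦ * l1 (y' - y₀')) + CΦ * Real.exp (-δΦ * l1 (y' - y₀')) :=
        (abs_add_le _ _).trans (add_le_add h1 h2)
    _ = (|a'| + CΦ) * Real.exp (-δΦ * l1 (y' - y₀')) := by ring

/-- [folklore] **(D-H) READ OFF — brick B6's END `LandauDictionaryHWeighted.wH_eq_HRcol_w` WITH ITS `hX1b` DISCHARGED**: for the road's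
display X₁a (`(r, a′, c)` free, `r ≠ 0`, `c ≠ 0`), a SYMMETRIC decaying `Ga` (`Spr Ga`, `hGaSymm`), and the shifted-multiplier kernel
`Cun′ := c⁻¹·(a′·δ + wΦ)`: the typed minimiser column IS `Ga𝒬ᵀCun′` (`wH(·; l) = HRcol n Ga Cun′ l 0`), the multiplier line is the
(tautological) `wΦ = c·Cun′ − a′·δ`, and `wM l = r • muCol n a Ga Cun′ l 0`.  Modulo X₁a ONLY — X₁b is no longer a hypothesis. -/
theorem wH_eq_HRcol_of_X1a (ha : 0 < a) (hr : r ≠ 0) (hc : c ≠ 0) (Ga : MKer 4 (Fin 4)) (hGa : Spr Ga)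
    (hGaSymm : ∀ x z κ m, Ga x z κ m = Ga z x m κ)
    (hX1a : ∀ (m : Fin 4) (z : Site 4) (κ : Fin 4) (x : Site 4),
      curvAdj (curv (fun κ' p => Ga p z κ' m)) κ x = c * delta1 m z κ x - r * dz (Rf n a (codiff₁ (fun κ' p => Ga p z κ' m))) κ x
        - a' * contourSumAdj n (contourSum n (fun κ' p => Ga p z κ' m)) κ x)
    (l : Fin 4) :
    (fun κ z => wH (N := n) κ l z)
        = LandauDictionaryH.HRcol n Ga (fun (y' y₀' : Site 4) (m l' : Fin 4) =>
            c⁻¹ * (a' * (if y' = y₀' ∧ m = l' then (1 : ℝ) else 0) + wΦ (N := n) m l' (y' - y₀'))) l 0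
      ∧ (fun κ y => wΦ (N := n) κ l y)
        = (fun κ y => c * (c⁻¹ * (a' * (if y = (0 : Site 4) ∧ κ = l then (1 : ℝ) else 0) + wΦ (N := n) κ l (y - 0)))
            - a' * (if y = 0 ∧ κ = l then 1 else 0))
      ∧ wM (N := n) l = r • LandauDictionaryH.muCol n a Ga (fun (y' y₀' : Site 4) (m l' : Fin 4) =>
            c⁻¹ * (a' * (if y' = y₀' ∧ m = l' then (1 : ℝ) else 0) + wΦ (N := n) m l' (y' - y₀'))) l 0 := by
  obtain ⟨CG, δG, hδG, hG⟩ := hGa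
  exact LandauDictionaryHWeighted.wH_eq_HRcol_w n a ha hr Ga _ ⟨CG, δG, hδG, hG⟩ (spr_shiftedMultiplier n a' c) hX1a
    (fun l₀ κ y => hX1b_of_X1a n a ha hr hc hG hδG hX1a hGaSymm l₀ κ y) l

end End

/-! ## §6 At the road's legs `Ga (m+1) a = K^∞` (owner's `LandauDictionaryInstance`): B6's `hX1b` modulo [B5] Prop. 1.2 ∧ (1.126)–(1.127) -/

section RoadLegs

open Summit.QuantumFields.BalabanUV.Beta.D1BFx.GluonLeg (Ga Ga_symm)
open Summit.QuantumFields.BalabanUV.Beta.D1BFx.GluonLegTails (spr_Ga_of_prop12)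
open Summit.QuantumFields.BalabanUV.Beta.D1BFx.LandauDictionaryInstance (hX1a_Ga)
open Summit.QuantumFields.BalabanUV.Beta.D1BFx.FrozenLegTails (nOf MOf hn1)
open VectorTailsLoc (fam kfam)

/-- [folklore] **B6's `hX1b` AT THE ROAD'S LEGS** — the RIGHT-inverse ∕ operator form of X₁b for `Ga (m+1) a`, with the constants of record
`(r, a′, c) = (2, 2a∕(m+1)⁸, 2)` (`LandauDictionaryInstance.hX1a_Ga` = `VectorLegEquation.vectorLeg_equation_weighted`) and `GluonLeg.Ga_symm`:
`𝒬(Ga𝒬ᵀ Cun′(·; l₀, 0)) = δ_{(l₀,0)}` for `Cun′ := ½·((2a∕(m+1)⁸)·δ + wΦ)`; conditional ONLY on the two PRINTED statements `h12 ∧ h126` (for `Spr Ga`),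
exactly as the owner's `X1b_Ga` (the LEFT form).  `wH_eq_HRcol_of_X1a` instantiates the same way. -/
theorem hX1b_Ga (m : ℕ) (ha : 0 < a) (h12 : B5.Prop12Printed (fam nOf hn1 MOf a ha))
    (h126 : B5.Kernel126_127Printed (kfam nOf MOf)) (l₀ κ : Fin 4) (y : Site 4) :
    contourSum (m + 1) (LandauDictionaryH.HRcol (m + 1) (Ga (m + 1) a) (fun (y' y₀' : Site 4) (m' l : Fin 4) =>
        (2 : ℝ)⁻¹ * ((2 * a / ((m + 1 : ℕ) : ℝ) ^ 8) * (if y' = y₀' ∧ m' = l then (1 : ℝ) else 0)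
          + wΦ (N := m + 1) m' l (y' - y₀'))) l₀ 0) κ y
      = if y = 0 ∧ κ = l₀ then 1 else 0 := by
  obtain ⟨C, δ, hδ, hGa⟩ := spr_Ga_of_prop12 ha h12 h126 (m + 1)
  have hn : 1 ≤ m + 1 := Nat.succ_le_succ (Nat.zero_le m)
  exact hX1b_of_X1a (m + 1) a ha two_ne_zero two_ne_zero hGa hδ (hX1a_Ga m ha)
    (fun x z κ' l => Ga_symm (m + 1) a hn ha x z κ' l) l₀ κ y

end RoadLegs

end

end Summit.QuantumFields.BalabanUV.Beta.D1BFx.LandauResolventSuperpositionRight
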